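import Summits.QuantumFields.YangMills.Theorems.UnitScaleTiltProp7FlatGramSection
import Summits.QuantumFields.YangMills.Theorems.UnitScaleTiltProp7SectET3OpsT3HilbertRows
import Literature.MathematicalPhysics.QuantumFieldTheory.Balaban1983to89.B9Eq3126GreenLettersVariational
import HarnessLib

/-!
# Route `UnitScaleTilt`, crux «MinimiserStabilityRegPr» (stmt-QuantumFields-19200), stub `stub_existenceMinimalOrbit` (EX), node N06(d = 3) — FLAT-CERT VECTOR ROAD, FILE V-1b:
# **THE FLOOR `μ₁(1)` OF THE GRAM OPERATOR `Q_k(1)·G(1)·Q_k(1)†` AT THE FLAT MEMBER, AND THE `L²` SIZES OF `(Q_kGQ_k†)⁻¹(1)` AND `H(1) = GQ_k†(Q_kGQ_k†)⁻¹(1)`, WITH NO OPERATOR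
# BOUND OF `Δ_a(1)`** ([Balaban1985BackgroundPropagators] Thm 3.11 p.416 «`Δ_a, G` positive definite», (3.126) p.420 «`HB = GQ*(QGQ*)⁻¹B`»; [Balaban1985Variational] (45)–(46) p.285
# «`|HB| ≤ B₀(Lʲη)⁻¹|B|`» — their `L²`-operator shadows at `U₀ = 1`)

Cell `ym3-torus`, width seat `ym3-torus-px7` (gen 6; WIDTH COPY «width 7» of ym3-torus-p1).  THEOREMS ONLY (0 `def`, 0 `sorry`); `--supports stmt-QuantumFields-19200 --as helper`;
count-neutral.  YM₃ on T³ is ladder rung R3, NOT d = 4, NOT the Clay problem; nothing here claims the stub, the crux, a curved-background row or the mass gap.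

WHY ∕ HOW.  FILE V-1a (`…FlatGramSection.exists_flat_section_energy`) supplies, for every block field `y`, a comparison field `X` with `Q_k(1)(toL2 X) = y` and `Δ_a(1)`-energy
`≤ M_u‖y‖²`, `M_u := (c₀∕cB)·ℓ³·(2721600 + a₀)`.  lit ✓`B9Eq3126GreenLettersVariational` (pub-balaban NE9 leaf-02: the first-order variational principle of [Balaban1984PropagatorsII]
(2.74)–(2.77) in abstract Hilbert letters) turns a test family with `β‖y‖² ≤ re⟪Q(u y), y⟫` (here `β = 1`) and energy `≤ M_u‖y‖²` into `(β²∕M_u)‖y‖² ≤ re⟪y, QG₁Q†y⟫`,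
`‖(QG₁Q†)⁻¹y‖ ≤ (M_u∕β²)‖y‖`, `‖H₁b‖ ≤ √(M_u∕(γβ²))‖b‖` — for `K := Q∘G1K∘Q†` over ANY `laplaceAK` with `hpos` and symmetry.  Brick L0d's total letters ARE these on px6's class
✓`posOnto_one` (✓`GT_of_pos`∕`KinvT_of_pos`∕`HT_of_pos`: `G1LatticeK`∕`KinvLatticeK`∕`H1LatticeK` unfold to `G1K`∕`KinvK`∕`H1K`); symmetry ✓`Prop7SectET3OpsT3HilbertRows.laplaceA_isSymmetric`
∘ ✓`DeltaEta_isSymmetric`; coercivity `γ = 1∕(4·Cst 3 a₀)` ✓`coercive_laplaceA_one`.  (Lit's own one-step instance of the same knit: ✓`B9Eq3126KFloorFlat`, on `fineP L m` carriers.)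

WHAT IS PROVED (ns `…Theorems.Prop7FlatGramFloor`; member `F n K`, `n < K`, `c₀ cB > 0`, `a₀ > 0`, `ℓ := L^{K−n}`, the display's weight `a := a₀·(c₀∕cB)·ℓ³`, slot `Δx` with `Δx 1 = Δ^η(1)`).
* §3 ★★★`norm_KinvT_one_le` `‖(Q_kGQ_k†)⁻¹(1) y‖ ≤ (c₀∕cB)·ℓ³·(2721600 + a₀)·‖y‖`; ★★★`re_inner_gram_one_ge` — THE FLOOR `((c₀∕cB)·ℓ³·(2721600 + a₀))⁻¹·‖y‖² ≤ re⟪y, Q_k(1)G(1)Q_k(1)†y⟫`;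
  ★★`norm_HT_one_le` `‖H(1) b‖ ≤ √((c₀∕cB)·ℓ³·(2721600 + a₀)·(4·Cst 3 a₀))·‖b‖`.
* §4 the same at the displayed slots: `re_inner_gram_one_ge_etaSlot` (`Δ^η`, the `hN06`∕(A′) slot), `norm_KinvT_one_le_etaSlot_add_TJ` (`Δ^η + T_Jᴾ`, the `hCk`∕`h137kΔ` slot),
  `norm_KinvT_one_le_piSlot` (`Δ_πᴾ`, the `h137kπ` slot) — FILE A ✓`deltaEtaSlot_add_TJSlotP_one`, px6 ✓`DeltaPiSlotP_one`.
THE UNITS POINT (said plainly, before anyone reads a «K-dependence» into it).  `Q_k(1)† = (cB∕c₀)·Q_kᵗ`, so `Q_k(1)G(1)Q_k(1)† = (cB∕c₀)·ℓ⁻³ × [print's QGQ* at η = ℓ⁻¹, c₀ = η³]`; on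
print's diagonal `c₀ = η³·cB` the floor is `(2721600 + a₀)⁻¹`, free of `K, n, m` and the volume, and the composite the displayed rows read, `Q_k(1)†∘KinvT(1) = ℓ³·Q_kᵗ(QGQ*)⁻¹ =` print's
`Q*(QGQ*)⁻¹`, is convention-free (px5 g4 LOCATE-2).  Likewise `H(1)` is print's `H` as a matrix and `√((c₀∕cB)ℓ³)` converts `‖·‖_{cB} → ‖·‖_{c₀}`.
HONEST SCOPE.  `U₀ = 1` only; `L²`-operator statements — NOT the pointwise kernel rows `h137kπ∕h137kΔ∕hCk` (they need the Combes–Thomas road on top of `μ₁`), NOT the curved rows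
(Thm 3.11∕3.12 at `U₀ ∈ RegPr`, N06); crude constants; no claim on any stub ∕ crux ∕ summit statement.

References: T. Bałaban, CMP **99** (1985) 389–434 [Balaban1985BackgroundPropagators] (Thm 3.11 p.416, (3.26)–(3.27) p.395, (3.119)–(3.126) pp.419–420, (3.147) p.425); CMP **102** (1985)
277–309 [Balaban1985Variational] ((45)–(46) p.285, (129)–(130) p.298, (137) p.298); CMP **96** (1984) 223–250 [Balaban1984PropagatorsII] ((2.74)–(2.77) p.236); CMP **95** (1984)
17–40 [Balaban1984PropagatorsI] (Prop. 1.1 (1.90) p.33).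
-/

set_option autoImplicit false

noncomputable section

open scoped InnerProductSpace ComplexConjugate Matrix.Norms.L2Operator BigOperators

namespace Summit.QuantumFields.YangMills.Theorems.Prop7FlatGramFloor

open Literature.MathematicalPhysics.QuantumFieldTheory.Balaban1983to89
open Literature.MathematicalPhysics.QuantumFieldTheory.Balaban1983to89.T3ContinuumYM3Torus
open B9Eq311L2Pairing (WL2)
open B11Eq103H1Complex (SiteL2K BondL2K)
open Summit.QuantumFields.YangMills.Theorems.Prop7SectET3Transport (periodsT3)
open Summit.QuantumFields.YangMills.Theorems.Prop7SectET3HilbertLetters (W₂ toL2 toL2B)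
open Summit.QuantumFields.YangMills.Theorems.Prop7SectET3WilsonHessian (DeltaEta DeltaEtaSlot DeltaEta_isSymmetric)
open Summit.QuantumFields.YangMills.Theorems.Prop7SectET3DeltaOnePInv (TJSlotP)
open Summit.QuantumFields.YangMills.Theorems.Prop7SectET3DeltaPiPInv (DeltaPiSlotP)
open Summit.QuantumFields.YangMills.Theorems.Prop7SectET3CurvedPropagators (Qk laplaceA PosOnto GT KinvT HT GT_of_pos KinvT_of_pos HT_of_pos)
open Summit.QuantumFields.YangMills.Theorems.Prop7LaplaceAFlatLetters (deltaEtaSlot_add_TJSlotP_one)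
open Summit.QuantumFields.YangMills.Theorems.Prop7LaplaceAFlatCoercive (coercive_laplaceA_one posOnto_one DeltaPiSlotP_one)
open Summit.QuantumFields.YangMills.Theorems.Prop7SectET3OpsT3HilbertRows (laplaceA_isSymmetric)
open Summit.QuantumFields.YangMills.Theorems.Prop7FlatGramSection (exists_flat_section_energy)

/-! ## §3 The floor `μ₁(1)`, the size of `(Q_kGQ_k†)⁻¹(1)` and of `H(1)` — lit's variational letters BY NAME at the member's total letters -/

section Floor

variable {F : T3Family} {n K : ℕ} {c₀ cB : ℝ} [Fact (0 < c₀)] [Fact (0 < cB)]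

/-- ★★★ **THE `L²` SIZE OF `(Q_kGQ_k†)⁻¹(1)`**: `‖KinvT … (a₀·(c₀∕cB)·ℓ³) Δx 1 y‖ ≤ (c₀∕cB)·ℓ³·(2721600 + a₀)·‖y‖` for `n < K`, `a₀ > 0`, any slot `Δx` with `Δx 1 = Δ^η(1)` —
lit ✓`B9Eq3126GreenLettersVariational.norm_KinvK_le_of_test` (`β = 1`, `M_u` = §2's energy) at brick L0d's total letter (✓`KinvT_of_pos` on px6's class ✓`posOnto_one`; symmetry
✓`laplaceA_isSymmetric` ∘ ✓`DeltaEta_isSymmetric`).  NO operator bound of `Δ_a(1)`.  On print's diagonal `c₀ = η³cB` the constant is `2721600 + a₀`.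
[cite: Balaban1985BackgroundPropagators, Thm 3.11 p.416, (3.122)–(3.126) p.420; Balaban1985Variational, (45) p.285; Balaban1984PropagatorsII, (2.74)–(2.77) p.236] -/
theorem norm_KinvT_one_le (hnK : n < K) {a₀ : ℝ} (ha₀ : 0 < a₀)
    (Δx : GaugeField (F.P K) 0 (Matrix.specialUnitaryGroup (Fin 2) ℂ) → (BondL2K ℂ 3 (periodsT3 F K) c₀ W₂ →ₗ[ℂ] BondL2K ℂ 3 (periodsT3 F K) c₀ W₂))
    (hΔ : Δx 1 = (DeltaEta F n K c₀ 1 : BondL2K ℂ 3 (periodsT3 F K) c₀ W₂ →ₗ[ℂ] BondL2K ℂ 3 (periodsT3 F K) c₀ W₂))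
    (y : WL2 ℂ (fun _ : PBond (F.P n) 0 => cB) W₂) :
    ‖KinvT F n K hnK.le c₀ cB (a₀ * (c₀ / cB) * ((F.L : ℝ) ^ (K - n)) ^ 3) Δx (1 : GaugeField (F.P K) 0 (Matrix.specialUnitaryGroup (Fin 2) ℂ)) y‖
      ≤ (c₀ / cB) * ((F.L : ℝ) ^ (K - n)) ^ 3 * (2721600 + a₀) * ‖y‖ := by
  have hc₀ : 0 < c₀ := Fact.out
  have hcB : 0 < cB := Fact.out
  have hL : (0 : ℝ) < F.L := by exact_mod_cast lt_trans zero_lt_one F.hL.2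
  have hp := posOnto_one (c₀ := c₀) hnK (cB := cB) ha₀ Δx hΔ
  have hTs := laplaceA_isSymmetric (h := hnK.le) (cB := cB) (a := a₀ * (c₀ / cB) * ((F.L : ℝ) ^ (K - n)) ^ 3) (Δx := Δx)
    (U₀ := (1 : GaugeField (F.P K) 0 (Matrix.specialUnitaryGroup (Fin 2) ℂ))) (by rw [hΔ]; exact DeltaEta_isSymmetric _)
  have hMu : 0 < (c₀ / cB) * ((F.L : ℝ) ^ (K - n)) ^ 3 * (2721600 + a₀) := by positivity
  choose u hu using exists_flat_section_energy (c₀ := c₀) (cB := cB) hnK a₀ Δx hΔ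
  have hux : ∀ y' : WL2 ℂ (fun _ : PBond (F.P n) 0 => cB) W₂,
      (1 : ℝ) * ‖y'‖ ^ 2 ≤ RCLike.re ⟪Qk F n K hnK.le c₀ cB (1 : GaugeField (F.P K) 0 (Matrix.specialUnitaryGroup (Fin 2) ℂ)) (toL2 F K c₀ (u y')), y'⟫_ℂ := by
    intro y'
    rw [(hu y').1, one_mul]
    exact (norm_sq_eq_re_inner (𝕜 := ℂ) y').le
  have huu := fun y' : WL2 ℂ (fun _ : PBond (F.P n) 0 => cB) W₂ => (hu y').2
  have h := B9Eq3126GreenLettersVariational.norm_KinvK_le_of_test (𝕜 := ℂ) (u := fun y' => toL2 F K c₀ (u y')) hp.pos B11Eq103H1Complex.hadj_adjoint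
    (B11Eq103H1Complex.adjoint_injective_of_surjective _ hp.onto) hTs hMu one_pos hux huu y
  rw [KinvT_of_pos hp]
  rw [one_pow, div_one] at h
  exact h

/-- ★★★ **THE FLOOR `μ₁(1)` OF THE GRAM OPERATOR AT THE FLAT MEMBER**: `((c₀∕cB)·ℓ³·(2721600 + a₀))⁻¹·‖y‖² ≤ re⟪y, Q_k(1)·G(1)·Q_k(1)† y⟫` — (3.126)∕Thm 3.11's lower bound for
`QGQ*` at `U₀ = 1`, by the first-order variational principle at §2's comparison field (lit ✓`re_inner_K_ge_of_test`).  Units: `Q_k(1)† = (cB∕c₀)Q_kᵗ`, so on print's diagonal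
`c₀ = η³cB` this is `QGQ* ≥ (2721600 + a₀)⁻¹`, free of `K, n, m` and the volume. [cite: Balaban1985BackgroundPropagators, Thm 3.11 p.416, (3.126) p.420; Balaban1984PropagatorsII, (2.74)–(2.77) p.236] -/
theorem re_inner_gram_one_ge (hnK : n < K) {a₀ : ℝ} (ha₀ : 0 < a₀)
    (Δx : GaugeField (F.P K) 0 (Matrix.specialUnitaryGroup (Fin 2) ℂ) → (BondL2K ℂ 3 (periodsT3 F K) c₀ W₂ →ₗ[ℂ] BondL2K ℂ 3 (periodsT3 F K) c₀ W₂))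
    (hΔ : Δx 1 = (DeltaEta F n K c₀ 1 : BondL2K ℂ 3 (periodsT3 F K) c₀ W₂ →ₗ[ℂ] BondL2K ℂ 3 (periodsT3 F K) c₀ W₂))
    (y : WL2 ℂ (fun _ : PBond (F.P n) 0 => cB) W₂) :
    ((c₀ / cB) * ((F.L : ℝ) ^ (K - n)) ^ 3 * (2721600 + a₀))⁻¹ * ‖y‖ ^ 2
      ≤ RCLike.re ⟪y, Qk F n K hnK.le c₀ cB (1 : GaugeField (F.P K) 0 (Matrix.specialUnitaryGroup (Fin 2) ℂ))
          (GT F n K hnK.le c₀ cB (a₀ * (c₀ / cB) * ((F.L : ℝ) ^ (K - n)) ^ 3) Δx (1 : GaugeField (F.P K) 0 (Matrix.specialUnitaryGroup (Fin 2) ℂ))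
            (LinearMap.adjoint (Qk F n K hnK.le c₀ cB (1 : GaugeField (F.P K) 0 (Matrix.specialUnitaryGroup (Fin 2) ℂ))) y))⟫_ℂ := by
  have hc₀ : 0 < c₀ := Fact.out
  have hcB : 0 < cB := Fact.out
  have hL : (0 : ℝ) < F.L := by exact_mod_cast lt_trans zero_lt_one F.hL.2
  have hp := posOnto_one (c₀ := c₀) hnK (cB := cB) ha₀ Δx hΔ
  have hTs := laplaceA_isSymmetric (h := hnK.le) (cB := cB) (a := a₀ * (c₀ / cB) * ((F.L : ℝ) ^ (K - n)) ^ 3) (Δx := Δx)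
    (U₀ := (1 : GaugeField (F.P K) 0 (Matrix.specialUnitaryGroup (Fin 2) ℂ))) (by rw [hΔ]; exact DeltaEta_isSymmetric _)
  have hMu : 0 < (c₀ / cB) * ((F.L : ℝ) ^ (K - n)) ^ 3 * (2721600 + a₀) := by positivity
  choose u hu using exists_flat_section_energy (c₀ := c₀) (cB := cB) hnK a₀ Δx hΔ
  have hux : ∀ y' : WL2 ℂ (fun _ : PBond (F.P n) 0 => cB) W₂,
      (1 : ℝ) * ‖y'‖ ^ 2 ≤ RCLike.re ⟪Qk F n K hnK.le c₀ cB (1 : GaugeField (F.P K) 0 (Matrix.specialUnitaryGroup (Fin 2) ℂ)) (toL2 F K c₀ (u y')), y'⟫_ℂ := by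
    intro y'
    rw [(hu y').1, one_mul]
    exact (norm_sq_eq_re_inner (𝕜 := ℂ) y').le
  have huu := fun y' : WL2 ℂ (fun _ : PBond (F.P n) 0 => cB) W₂ => (hu y').2
  have h := B9Eq3126GreenLettersVariational.re_inner_K_ge_of_test (𝕜 := ℂ) (u := fun y' => toL2 F K c₀ (u y')) hp.pos B11Eq103H1Complex.hadj_adjoint
    hTs hMu zero_le_one hux huu y
  rw [GT_of_pos hp]
  rw [one_pow, one_div] at h
  exact h

/-- ★★ **THE `L²` SIZE OF `H(1) = GQ_k†(Q_kGQ_k†)⁻¹(1)`**: `‖HT … 1 b‖ ≤ √((c₀∕cB)·ℓ³·(2721600 + a₀)·(4·Cst 3 a₀))·‖b‖` — [Balaban1985Variational] (46)'s `|HB| ≤ B₀|B|` as an `L²`-operator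
statement at `U₀ = 1` (lit ✓`norm_H1K_le_of_test` with px6's coercivity constant `γ = 1∕(4·Cst 3 a₀)` ✓`coercive_laplaceA_one`).  Units: `H(1)` is print's `H` as a matrix; the factor
`√((c₀∕cB)ℓ³)` converts `‖·‖_{cB} → ‖·‖_{c₀}`. [cite: Balaban1985Variational, (45)–(46) p.285; Balaban1985BackgroundPropagators, (3.126) p.420, Thm 3.11 p.416] -/
theorem norm_HT_one_le (hnK : n < K) {a₀ : ℝ} (ha₀ : 0 < a₀)
    (Δx : GaugeField (F.P K) 0 (Matrix.specialUnitaryGroup (Fin 2) ℂ) → (BondL2K ℂ 3 (periodsT3 F K) c₀ W₂ →ₗ[ℂ] BondL2K ℂ 3 (periodsT3 F K) c₀ W₂))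
    (hΔ : Δx 1 = (DeltaEta F n K c₀ 1 : BondL2K ℂ 3 (periodsT3 F K) c₀ W₂ →ₗ[ℂ] BondL2K ℂ 3 (periodsT3 F K) c₀ W₂))
    (b : WL2 ℂ (fun _ : PBond (F.P n) 0 => cB) W₂) :
    ‖HT F n K hnK.le c₀ cB (a₀ * (c₀ / cB) * ((F.L : ℝ) ^ (K - n)) ^ 3) Δx (1 : GaugeField (F.P K) 0 (Matrix.specialUnitaryGroup (Fin 2) ℂ)) b‖
      ≤ Real.sqrt ((c₀ / cB) * ((F.L : ℝ) ^ (K - n)) ^ 3 * (2721600 + a₀) * (4 * B5Prop11Plancherel.Cst 3 a₀)) * ‖b‖ := by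
  have hc₀ : 0 < c₀ := Fact.out
  have hcB : 0 < cB := Fact.out
  have hL : (0 : ℝ) < F.L := by exact_mod_cast lt_trans zero_lt_one F.hL.2
  have hC : 0 < B5Prop11Plancherel.Cst 3 a₀ := B5Prop11Lattice.Cst_pos (d := 3) (a := a₀)
  have hp := posOnto_one (c₀ := c₀) hnK (cB := cB) ha₀ Δx hΔ
  have hTs := laplaceA_isSymmetric (h := hnK.le) (cB := cB) (a := a₀ * (c₀ / cB) * ((F.L : ℝ) ^ (K - n)) ^ 3) (Δx := Δx)
    (U₀ := (1 : GaugeField (F.P K) 0 (Matrix.specialUnitaryGroup (Fin 2) ℂ))) (by rw [hΔ]; exact DeltaEta_isSymmetric _)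
  have hMu : 0 < (c₀ / cB) * ((F.L : ℝ) ^ (K - n)) ^ 3 * (2721600 + a₀) := by positivity
  have hγ : 0 < 1 / (4 * B5Prop11Plancherel.Cst 3 a₀) := by positivity
  have hcoer := coercive_laplaceA_one (c₀ := c₀) (h := hnK.le) (cB := cB) ha₀ Δx hΔ
  choose u hu using exists_flat_section_energy (c₀ := c₀) (cB := cB) hnK a₀ Δx hΔ
  have hux : ∀ y' : WL2 ℂ (fun _ : PBond (F.P n) 0 => cB) W₂,
      (1 : ℝ) * ‖y'‖ ^ 2 ≤ RCLike.re ⟪Qk F n K hnK.le c₀ cB (1 : GaugeField (F.P K) 0 (Matrix.specialUnitaryGroup (Fin 2) ℂ)) (toL2 F K c₀ (u y')), y'⟫_ℂ := by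
    intro y'
    rw [(hu y').1, one_mul]
    exact (norm_sq_eq_re_inner (𝕜 := ℂ) y').le
  have huu := fun y' : WL2 ℂ (fun _ : PBond (F.P n) 0 => cB) W₂ => (hu y').2
  have h := B9Eq3126GreenLettersVariational.norm_H1K_le_of_test (𝕜 := ℂ) (u := fun y' => toL2 F K c₀ (u y')) hp.pos B11Eq103H1Complex.hadj_adjoint
    (B11Eq103H1Complex.adjoint_injective_of_surjective _ hp.onto) hγ hcoer hTs hMu one_pos hux huu b
  rw [HT_of_pos hp]
  refine h.trans (le_of_eq ?_)
  congr 1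
  congr 1
  rw [one_pow, mul_one, div_div_eq_mul_div, div_one]

end Floor

/-! ## §4 The three displayed slots at the flat member: `Δ^η`, `Δ^η + T_Jᴾ`, `Δ_πᴾ` (all equal `Δ^η(1)` by FILE A ∕ px6) -/

section Slots

variable {F : T3Family} {n K : ℕ} {c₀ cB : ℝ} [Fact (0 < c₀)] [Fact (0 < cB)]

/-- ★★ **THE FLOOR AT THE `Δ^η` SLOT** (`G₀ = (Δ^η + DRD* + Q*aQ)⁻¹` of [B9] p.421 — the `hN06`∕(A′) slot). [cite: Balaban1985BackgroundPropagators, Thm 3.11 p.416, (3.126) p.420, p.421] -/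
theorem re_inner_gram_one_ge_etaSlot (hnK : n < K) {a₀ : ℝ} (ha₀ : 0 < a₀) (y : WL2 ℂ (fun _ : PBond (F.P n) 0 => cB) W₂) :
    ((c₀ / cB) * ((F.L : ℝ) ^ (K - n)) ^ 3 * (2721600 + a₀))⁻¹ * ‖y‖ ^ 2
      ≤ RCLike.re ⟪y, Qk F n K hnK.le c₀ cB (1 : GaugeField (F.P K) 0 (Matrix.specialUnitaryGroup (Fin 2) ℂ))
          (GT F n K hnK.le c₀ cB (a₀ * (c₀ / cB) * ((F.L : ℝ) ^ (K - n)) ^ 3) (DeltaEtaSlot F n K c₀) (1 : GaugeField (F.P K) 0 (Matrix.specialUnitaryGroup (Fin 2) ℂ))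
            (LinearMap.adjoint (Qk F n K hnK.le c₀ cB (1 : GaugeField (F.P K) 0 (Matrix.specialUnitaryGroup (Fin 2) ℂ))) y))⟫_ℂ :=
  re_inner_gram_one_ge hnK ha₀ _ rfl y

/-- ★★ **THE SIZE OF `(Q_kGQ_k†)⁻¹(1)` AT THE `Δ^η + T_Jᴾ` SLOT** (the display's `hCk`∕`h137kΔ` slot; `T_Jᴾ(1) = 0` by FILE A ✓`deltaEtaSlot_add_TJSlotP_one`). [cite: Balaban1985BackgroundPropagators, (3.126) p.420, (3.147) p.425; Balaban1985Variational, (129)–(130) p.298] -/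
theorem norm_KinvT_one_le_etaSlot_add_TJ (hnK : n < K) {a₀ : ℝ} (ha₀ : 0 < a₀) (a' : ℝ) (y : WL2 ℂ (fun _ : PBond (F.P n) 0 => cB) W₂) :
    ‖KinvT F n K hnK.le c₀ cB (a₀ * (c₀ / cB) * ((F.L : ℝ) ^ (K - n)) ^ 3)
        (fun U₀ => DeltaEtaSlot F n K c₀ U₀ + TJSlotP F n K hnK.le c₀ cB a' U₀) (1 : GaugeField (F.P K) 0 (Matrix.specialUnitaryGroup (Fin 2) ℂ)) y‖
      ≤ (c₀ / cB) * ((F.L : ℝ) ^ (K - n)) ^ 3 * (2721600 + a₀) * ‖y‖ :=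
  norm_KinvT_one_le hnK ha₀ _ (deltaEtaSlot_add_TJSlotP_one) y

/-- ★★ **THE SIZE OF `(Q_kGQ_k†)⁻¹(1)` AT THE `Δ_πᴾ` SLOT** (the display's `h137kπ` slot; `Δ_πᴾ(1) = Δ^η(1)` by px6 ✓`DeltaPiSlotP_one`). [cite: Balaban1985BackgroundPropagators, (3.119)–(3.126) pp.419–420; Balaban1985Variational, (137) p.298] -/
theorem norm_KinvT_one_le_piSlot (hnK : n < K) {a₀ : ℝ} (ha₀ : 0 < a₀) (a' : ℝ) (y : WL2 ℂ (fun _ : PBond (F.P n) 0 => cB) W₂) :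
    ‖KinvT F n K hnK.le c₀ cB (a₀ * (c₀ / cB) * ((F.L : ℝ) ^ (K - n)) ^ 3)
        (DeltaPiSlotP F n K hnK.le c₀ cB a') (1 : GaugeField (F.P K) 0 (Matrix.specialUnitaryGroup (Fin 2) ℂ)) y‖
      ≤ (c₀ / cB) * ((F.L : ℝ) ^ (K - n)) ^ 3 * (2721600 + a₀) * ‖y‖ :=
  norm_KinvT_one_le hnK ha₀ _ DeltaPiSlotP_one y

end Slots

end Summit.QuantumFields.YangMills.Theorems.Prop7FlatGramFloor

end
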